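import Summits.BirchSwinnertonDyer.BirchSwinnertonDyer.Theorems.ByReductionTypeAtTwoRankOneSharpFlatEtaCapstoneAtTwo
import Summits.BirchSwinnertonDyer.Rank1Residual.Additive.KatoDescentIntegralH1KummerIndex
import HarnessLib

/-!
# Capstone of the ♯/♭ ↔ η dictionary, `log_ω`-binder DISCHARGED: `B56 → 56A-K → K2-Kss` outright
# (and `B56 → 56A → (PR ≠ 0 on slice data) → K2-Vss`, `B56 → 56A-L → (PR ≠ 0) → K2-Lss`)

Cell `bsd-f1-sign2`, seat `-an` g54 (MEMO-an §56.10; D-0182 finish-and-book), crux `stmt-BirchSwinnertonDyer-23715`; helper file,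
closes nothing, asserts nothing new.

The g52/g54 capstone `twoAdicKatoBoundEtaRankOneSs_of_perrinRiouKatoHalf` (`…SharpFlatEtaCapstoneAtTwo`) carried one non-structural
binder `hlog : ∀ W P, IsMordellWeilBasis P → logOmegaAt W 2 (P 0) ≠ 0` ("the formal logarithm of a point of infinite order is non-zero",
AEC IV.6.4 + VII.6.3).  That statement is ALREADY a tree theorem in the additive cell's Kato-descent kernel:
`Rank1Residual.Additive.LocPKummer.padicLogLocal_map_ne_zero : ¬ IsOfFinAddOrder P → padicLogLocal W p (Point.map (ofId ℚ ℚ_p) P) ≠ 0`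
(`log_ω = 0 ⟹ torsion in E(ℚ_p)` by `isOfFinAddOrder_of_padicLogLocal_eq_zero`, and `E(ℚ) → E(ℚ_p)` is an injective homomorphism),
and `logOmegaAt W p P` is `padicLogLocal W p (pointToPadic W p P)` with `pointToPadic = Point.map (Algebra.ofId ℚ ℚ_p)` by definition.
This file records the discharge:
* `logOmegaAt_ne_zero_of_not_isOfFinAddOrder` — `¬ IsOfFinAddOrder P → logOmegaAt W p P ≠ 0` (any prime `p`);
* `logOmegaAt_ne_zero_of_isMordellWeilBasis` — for a one-element Mordell–Weil basis `P`, `logOmegaAt W p (P 0) ≠ 0`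
  (the two `DecidableEq ℚ` instances of the point group — classical in `IsMordellWeilBasis`, `instDecidableEqRat` here — are equal by
  `Subsingleton.elim`);
* `twoAdicKatoBoundEtaRankOneSs_of_perrinRiouKatoHalf'` — **`SprungEtaBridgeAtTwo → PerrinRiouKatoHalfAtTwo → TwoAdicKatoBoundEtaRankOneSs`**
  (no further binder: the -an Kato half 56A-K and the arithmetic-free bridge B56 DELIVER the -es Kato half K2-Kss);
* `twoAdicBSDEtaValRankOneSs_of_perrinRiouShaOrder'`, `twoAdicLowerBoundEtaRankOneSs_of_perrinRiouLowerHalf'` — the K2-Vss / K2-Lss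
  versions with the single remaining binder `PR ≠ 0` on the slice data (the -an non-degeneracy 55A′ read through `Ш_an ≠ 0`; a binder,
  never asserted).
BSD is not proved by any of this; 23715 is not closed.  References: [cite: SilvermanAEC2009, IV.6.4, VII.6.3] [cite: Kato2004, Thm. 12.5]
[cite: Sprung2012, §§4–6].
-/

namespace Summit.BirchSwinnertonDyer.BirchSwinnertonDyer.Theorems.PerrinRiouElementAtTwo

set_option linter.dupNamespace false

open scoped Classical MatrixGroups ModularForm
open CongruenceSubgroup WeierstrassCurve Literature.NumberTheory.EllipticCurves Literature.NumberTheory.EllipticCurves.ModularForms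
  Literature.NumberTheory.EllipticCurves.Sprung2017 Literature.NumberTheory.EllipticCurves.Rank1Residual
  Summit.BirchSwinnertonDyer.Rank1Residual.F1Sign2

/-- **A rational point of infinite order has `log_ω(P) ≠ 0`** (`logOmegaAt` spelling of the tree theorem
`Rank1Residual.Additive.LocPKummer.padicLogLocal_map_ne_zero`). [cite: SilvermanAEC2009, IV.6.4 and VII.6.3] -/
theorem logOmegaAt_ne_zero_of_not_isOfFinAddOrder (W : WeierstrassCurve ℚ) [W.IsElliptic] [W.IsGloballyMinimal] (p : ℕ) [Fact p.Prime]
    {P : W.toAffine.Point} (hP : ¬ IsOfFinAddOrder P) : logOmegaAt W p P ≠ 0 :=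
  Summit.BirchSwinnertonDyer.Rank1Residual.Additive.LocPKummer.padicLogLocal_map_ne_zero W p hP

/-- For a one-element Mordell–Weil basis `P` of `W(ℚ)`, `log_ω(P 0) ≠ 0` at every prime. [cite: SilvermanAEC2009, IV.6.4 and VII.6.3] -/
theorem logOmegaAt_ne_zero_of_isMordellWeilBasis (W : WeierstrassCurve ℚ) [W.IsElliptic] [W.IsGloballyMinimal] (p : ℕ) [Fact p.Prime]
    (P : Fin 1 → W.toAffine.Point) (hP : IsMordellWeilBasis P) : logOmegaAt W p (P 0) ≠ 0 := by
  have hnt := not_isOfFinAddOrder_zero_of_isMordellWeilBasis hP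
  have hdec : (fun a b : ℚ => Classical.propDecidable (a = b)) = instDecidableEqRat := Subsingleton.elim _ _
  rw [hdec] at hnt
  exact logOmegaAt_ne_zero_of_not_isOfFinAddOrder W p hnt

/-- **56A-K ∧ B56 ⟹ K2-Kss, outright**: the -an Kato half (♯/♭ currency) and the arithmetic-free bridge deliver the -es Kato half
(η currency) of the supersingular slice of 23715 — the `log_ω ≠ 0` binder of `twoAdicKatoBoundEtaRankOneSs_of_perrinRiouKatoHalf`
discharged by `logOmegaAt_ne_zero_of_isMordellWeilBasis`. [folklore] -/
theorem twoAdicKatoBoundEtaRankOneSs_of_perrinRiouKatoHalf' (hB : SprungEtaBridgeAtTwo) (hK : PerrinRiouKatoHalfAtTwo) :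
    TwoAdicKatoBoundEtaRankOneSs :=
  twoAdicKatoBoundEtaRankOneSs_of_perrinRiouKatoHalf hB hK (fun W _ _ P hP => logOmegaAt_ne_zero_of_isMordellWeilBasis W 2 P hP)

/-- **56A ∧ B56 ∧ (`PR ≠ 0` on the slice data) ⟹ K2-Vss** (`log_ω` binder discharged). [folklore] -/
theorem twoAdicBSDEtaValRankOneSs_of_perrinRiouShaOrder' (hB : SprungEtaBridgeAtTwo) (h56 : PerrinRiouShaOrderAtTwo)
    (hPRnd : ∀ {N : ℕ} [NeZero N] (f : CuspForm (Gamma0 N) 2) (W : WeierstrassCurve ℚ) [W.IsElliptic] [W.IsGloballyMinimal]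
      (Lsharp Lflat : IwasawaAlgebra 2), SliceAtTwo W → GoodSS W 2 → W.analyticRank = 1 → IsNewformOf W f →
      IsSprungPair f 2 (W.frobeniusTrace 2) Lsharp Lflat → prComb (W.frobeniusTrace 2) Lsharp Lflat ≠ 0) :
    TwoAdicBSDEtaValRankOneSs :=
  twoAdicBSDEtaValRankOneSs_of_perrinRiouShaOrder hB h56 (fun W _ _ P hP => logOmegaAt_ne_zero_of_isMordellWeilBasis W 2 P hP) hPRnd

/-- **56A-L ∧ B56 ∧ (`PR ≠ 0` on the slice data) ⟹ K2-Lss** (`log_ω` binder discharged). [folklore] -/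
theorem twoAdicLowerBoundEtaRankOneSs_of_perrinRiouLowerHalf' (hB : SprungEtaBridgeAtTwo) (hL56 : PerrinRiouLowerHalfAtTwo)
    (hPRnd : ∀ {N : ℕ} [NeZero N] (f : CuspForm (Gamma0 N) 2) (W : WeierstrassCurve ℚ) [W.IsElliptic] [W.IsGloballyMinimal]
      (Lsharp Lflat : IwasawaAlgebra 2), SliceAtTwo W → GoodSS W 2 → W.analyticRank = 1 → IsNewformOf W f →
      IsSprungPair f 2 (W.frobeniusTrace 2) Lsharp Lflat → prComb (W.frobeniusTrace 2) Lsharp Lflat ≠ 0) :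
    TwoAdicLowerBoundEtaRankOneSs :=
  twoAdicLowerBoundEtaRankOneSs_of_perrinRiouLowerHalf hB hL56 (fun W _ _ P hP => logOmegaAt_ne_zero_of_isMordellWeilBasis W 2 P hP)
    hPRnd

end Summit.BirchSwinnertonDyer.BirchSwinnertonDyer.Theorems.PerrinRiouElementAtTwo
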